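import Summits.BirchSwinnertonDyer.BirchSwinnertonDyer.Theorems.PrintX9MuPartSpecWitnessOfDVRConclusion
import Literature.NumberTheory.GaloisCohomology.Howard2004.ConclusionHonestModuleProofs
import Literature.NumberTheory.GaloisCohomology.Howard2004.ConclusionTorsionCurrencyProofs
import Literature.NumberTheory.EllipticCurves.IwasawaDualCompatOfTCompatProofs
import Literature.NumberTheory.EllipticCurves.IwasawaAlgebraEisensteinCoefficientRingProofs
import HarnessLib

/-!
# TURNKEY (discrete side): a `SpecWitness` at `q_m` from Howard's Thm 1.6.1 CONCLUSION on a `DVRSetting` over `S_m`, the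
# compact glue, and a READOUT `H¹(K, A) → H¹(K_∞, E[p^∞])` of the discrete Selmer module — the `𝒜`-side transport done
# (helper for the shared μ-crux `MuInequalityCoherentPair{OfHoward,OfPrint}`, STUB B `stub_controlGlue`; cell `pub/bsd-print-x9`,
# seat `bsd-line-x10b-p1-w2` g10, claim (DG3))

Summits-side helper; THEOREMS ONLY, no definition, no named fact, no `sorry`. ROUTE-INDEPENDENT; namespace of the witness
interface (`…Theorems.HeegnerMuPartStabilized`). GENERIC in the setting: ANY `St : Howard2004.DVRSetting p K S_m …`
(`S_m = Λ/(T^m + p)`), so the E-instantiation `St := W.eisensteinDVRSetting …` is one application.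

WHAT. `nonempty_specWitness_of_dvrConclusion_of_readout`: the glue `nonempty_specWitness_of_dvrConclusion_one` (p653022)
wants, on the DISCRETE side, an honest `S_m`/`Λ`-module `𝒜` with an `S_m`-LINEAR `e𝒜 : 𝒜 ≃ FracModR S_m × (M × M)`, the bound
`hbound`, and a `Λ`-linear `h : 𝒳/q_m 𝒳 → Hom(𝒜, ℚ/ℤ)` with `#ker h ≤ c`. This file PRODUCES all of them from
`St.Conclusion hy one` (UNOPENED — the binder `h161 …` of the skeleton hands exactly this) and a readout
`ι₀ : H¹(K, A) = AdicTower.H1A … →+ H¹(K_∞, E[p^∞])` (x10b-p2's `eisensteinTowerReadout`) subject to THREE binders in the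
x10b-p2 currency: **(hT)** `ι₀ [T̄ • c] = (conj_γ − 1) ι₀ [c]` on representatives (their (B3)), **(hSel)** `ι₀ (H¹_F(K, A)) ⊆
Sel_{p^∞}(E/K_∞)` (their (B4)), **(hfin)/(hidx)** `#(Sel_∞[ψ_m] ⧸ ι₀(H¹_F(K, A))) ≤ c` (their (B5), `ψ_m = (conj_γ − 1)^m + p`).
Inside: `𝒜 := FracModR S_m × (M × M)` itself (`e𝒜 := LinearEquiv.refl`), `Λ` acting through `Λ → S_m` (`Module.compHom`);
the comparison `ι𝒜 := ι₀ ∘ Φ⁻¹ : 𝒜 → Sel_∞` is `T`-compatible by `DVRSetting.exists_of_eq_coe_symm_and_smul` (p664928: `Φ⁻¹` is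
`S_m`-semilinear for the levelwise action, from the printed equivariance clause + `R`-stability of `H¹_F(K, A)`, p664545) and (hT);
`𝒜` is `p`- and `T`-power torsion (`FracModR.exists_pow_smul_prod_eq_zero`, p665691, with `SatisfiesH.unif`, and `T̄, p ∈ 𝔪_{S_m}`);
hence `Λ`-compatible (`SelmerDualData.toDual_smul_apply_eq_of_X_compat`, p665265) and killed by `ψ_m`; then p643117 gives `h`
with `#ker h = #(Sel_∞[ψ_m] ⧸ range ι𝒜)` and `range ι𝒜 = ι₀(H¹_F(K, A))` (Φ is onto). The compact inputs (`H, ι, f, κ₁, …`) are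
passed through verbatim (they are the g9 turnkey `exists_forall_compactInputs_eisensteinDVRSetting`, p660971, for the E-setting).
HONEST FRAMING: nothing here constructs the readout, its Selmer containment or the index bound (x10b-p2's F2–F7, incl. the
Coates–Greenberg input at `v ∣ p`); «beyond-print theorem»: no. BSD is not proved by any of this; no summit statement is
proved by this seat.

References: [Howard2004HeegnerKolyvagin] Thm. 1.6.1, Lemma 2.2.7 / Prop. 2.2.8 (second map) and proof of Thm. 2.2.10
(𝔮 = T^m + p); [GreenbergLNM1716] §4 p. 98 (`X/θX` dual to `Sel[θ]`); [MastellaZerman2026] Thm. 2.40 (shape of the witness).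
-/

set_option linter.dupNamespace false
set_option autoImplicit false

noncomputable section

open scoped Classical Pointwise nonZeroDivisors

open Literature Literature.NumberTheory.EllipticCurves WeierstrassCurve NumberField IsDedekindDomain Field
open Literature.NumberTheory.GaloisCohomology.Howard2004 Literature.NumberTheory.GaloisRepresentations
open Literature.NumberTheory.GaloisRepresentations.galoisCohomology

namespace Summit.BirchSwinnertonDyer.BirchSwinnertonDyer.Theorems.HeegnerMuPartStabilized

/-! ## §1 Two small facts on `S_m = Λ/(T^m + p)` -/

/-- `T̄ = T mod (T^m + p)` lies in the maximal ideal of `S_m` (it is not a unit, tree `IwasawaAlgebra.not_isUnit_mk_X`).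
[cite: Howard2004HeegnerKolyvagin, §2.2 (S_𝔮 a DVR) and proof of Thm. 2.2.10 (𝔮 = T^m + p)] -/
theorem mk_X_mem_maximalIdeal {p : ℕ} [Fact p.Prime] {m : ℕ} (hm : 1 ≤ m)
    [IsLocalRing (IwasawaAlgebra p ⧸ Ideal.span {(PowerSeries.X ^ m + PowerSeries.C (p : ℤ_[p]) : IwasawaAlgebra p)})] :
    Ideal.Quotient.mk (Ideal.span {(PowerSeries.X ^ m + PowerSeries.C (p : ℤ_[p]) : IwasawaAlgebra p)}) PowerSeries.X ∈
      IsLocalRing.maximalIdeal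
        (IwasawaAlgebra p ⧸ Ideal.span {(PowerSeries.X ^ m + PowerSeries.C (p : ℤ_[p]) : IwasawaAlgebra p)}) :=
  (IsLocalRing.mem_maximalIdeal _).mpr (IwasawaAlgebra.not_isUnit_mk_X p hm)

/-- `p = -T̄^m` lies in the maximal ideal of `S_m`. [cite: Howard2004HeegnerKolyvagin, proof of Thm. 2.2.10 (𝔮 = T^m + p)] -/
theorem natCast_p_mem_maximalIdeal {p : ℕ} [Fact p.Prime] {m : ℕ} (hm : 1 ≤ m)
    [IsLocalRing (IwasawaAlgebra p ⧸ Ideal.span {(PowerSeries.X ^ m + PowerSeries.C (p : ℤ_[p]) : IwasawaAlgebra p)})] :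
    ((p : IwasawaAlgebra p ⧸ Ideal.span {(PowerSeries.X ^ m + PowerSeries.C (p : ℤ_[p]) : IwasawaAlgebra p)})) ∈
      IsLocalRing.maximalIdeal
        (IwasawaAlgebra p ⧸ Ideal.span {(PowerSeries.X ^ m + PowerSeries.C (p : ℤ_[p]) : IwasawaAlgebra p)}) := by
  rw [IwasawaAlgebra.natCast_eq_neg_mk_X_pow_quotient_X_pow_add_C p m, Ideal.neg_mem_iff]
  exact Ideal.pow_mem_of_mem _ (mk_X_mem_maximalIdeal hm) m hm

/-- In a module over a commutative ring: if `ϖ^N • y = 0` and `a ∈ (ϖ)`, then `a^N • y = 0`.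
[cite: Howard2004HeegnerKolyvagin, proof of Thm. 2.2.10 (𝔮 = T^m + p)] -/
theorem pow_smul_eq_zero_of_mem_span {R : Type*} [CommRing R] {M : Type*} [AddCommGroup M] [Module R M]
    {ϖ a : R} (ha : a ∈ Ideal.span {ϖ}) {N : ℕ} {y : M} (hy : ϖ ^ N • y = 0) : a ^ N • y = 0 := by
  obtain ⟨b, rfl⟩ := Ideal.mem_span_singleton'.mp ha
  rw [mul_pow, mul_smul, hy, smul_zero]

/-- **`ψ_m = (conj_γ − 1)^m + p` kills `ι(B)`** when `ι` is `T`-compatible and `(T^m + p) • b = 0` in the honest `Λ`-module `B`.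
[cite: Howard2004HeegnerKolyvagin, proof of Thm. 2.2.10 (𝔮 = T^m + p)] [cite: GreenbergLNM1716, §4 p. 98] -/
theorem psi_apply_eq_zero_of_X_compat {p : ℕ} [Fact p.Prime] (m : ℕ) {K : Type} [Field K] [NumberField K]
    (V : WeierstrassCurve K) [V.IsElliptic] {κ : ZpExtension K p} (γ : absoluteGaloisGroup K)
    {B : Type*} [AddCommGroup B] [Module (IwasawaAlgebra p) B] (ι : B →+ V.selmerInfty κ)
    (hT : ∀ b : B, ι ((PowerSeries.X : IwasawaAlgebra p) • b) = (V.conjSelmerInfty κ γ - 1) (ι b))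
    (b : B) (hb : ((PowerSeries.X : IwasawaAlgebra p) ^ m + (p : IwasawaAlgebra p)) • b = 0) :
    ((V.conjSelmerInfty κ γ - 1) ^ m + (p : AddMonoid.End (V.selmerInfty κ))) (ι b) = 0 := by
  change ((V.conjSelmerInfty κ γ - 1) ^ m) (ι b) + (p : AddMonoid.End (V.selmerInfty κ)) (ι b) = 0
  rw [← IwasawaDual.IsDualPair.apply_X_pow_smul_of_X_compat ι hT m b, AddMonoid.End.natCast_apply,
    ← map_nsmul, ← map_add, ← Nat.cast_smul_eq_nsmul (IwasawaAlgebra p) p b, ← add_smul, hb, map_zero]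

/-! ## §2 The dual control map from a readout of an honest module (setting-free) -/

/-- **The dual control map `h : 𝒳/q_m 𝒳 → Hom(P, ℚ/ℤ)` with `#ker h ≤ c`**, SETTING-FREE: `P` is an honest `S_m`-module of
`π`-power torsion (`S_m` a DVR with `𝔪 = (π)`; e.g. Thm. 1.6.1's `𝒟 × (M × M)`) carrying the `Λ`-structure through `Λ → S_m`
(hsmul); given an additive identification `Φ : 𝒮 ≃ P` of a subgroup `𝒮 ≤ H₁` (Howard's `H¹_F(K, A) ⊂ H¹(K, A)`), a readout
`ι₀ : H₁ → H¹(K_∞, E[p^∞])` with `ι₀ Φ⁻¹(T̄ • y) = (conj_γ − 1) ι₀ Φ⁻¹(y)` (hT), `ι₀(𝒮) ⊆ Sel_∞` (hSel) and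
`#(Sel_∞[ψ_m] ⧸ ι₀(𝒮)) ≤ c` (hfin, hidx), there is a `Λ`-linear `h : 𝒳/q_m 𝒳 → Hom(P, ℚ/ℤ)` with finite kernel of cardinality
`≤ c`. [cite: Howard2004HeegnerKolyvagin, Prop. 2.2.8 and proof of Thm. 2.2.10 (𝔮 = T^m + p)] [cite: GreenbergLNM1716, §4 p. 98] -/
theorem exists_linearMap_characterModule_of_readout {p : ℕ} [hp : Fact p.Prime] {m : ℕ} (hm : 1 ≤ m)
    [IsDomain (IwasawaAlgebra p ⧸ Ideal.span {(PowerSeries.X ^ m + PowerSeries.C (p : ℤ_[p]) : IwasawaAlgebra p)})] [IsDiscreteValuationRing (IwasawaAlgebra p ⧸ Ideal.span {(PowerSeries.X ^ m + PowerSeries.C (p : ℤ_[p]) : IwasawaAlgebra p)})]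
    {K : Type} [Field K] [NumberField K] (V : WeierstrassCurve K) [V.IsElliptic] {κ : ZpExtension K p}
    {γ : absoluteGaloisGroup K} (hγ : κ.IsTopGenerator γ) (𝒳 : V.SelmerDualData κ γ)
    {π : (IwasawaAlgebra p ⧸ Ideal.span {(PowerSeries.X ^ m + PowerSeries.C (p : ℤ_[p]) : IwasawaAlgebra p)})} (hunif : IsLocalRing.maximalIdeal (IwasawaAlgebra p ⧸ Ideal.span {(PowerSeries.X ^ m + PowerSeries.C (p : ℤ_[p]) : IwasawaAlgebra p)}) = Ideal.span {π})
    {P : Type} [AddCommGroup P] [Module (IwasawaAlgebra p ⧸ Ideal.span {(PowerSeries.X ^ m + PowerSeries.C (p : ℤ_[p]) : IwasawaAlgebra p)}) P] [Module (IwasawaAlgebra p) P]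
    (hsmul : ∀ (g : IwasawaAlgebra p) (y : P), g • y = Ideal.Quotient.mk (Ideal.span {(PowerSeries.X ^ m + PowerSeries.C (p : ℤ_[p]) : IwasawaAlgebra p)}) g • y)
    (hPtor : ∀ y : P, ∃ N : ℕ, π ^ N • y = 0)
    {H₁ : Type} [AddCommGroup H₁] (𝒮 : AddSubgroup H₁) (Φ : ↥𝒮 ≃+ P)
    (ι₀ : H₁ →+ V.subgroupH1 p κ.kerSubgroup)
    (θ : AddMonoid.End (V.subgroupH1 p κ.kerSubgroup)) (hθ : ∀ s, θ s = V.conjH1 p κ.kerSubgroup γ s)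
    (hT : ∀ y : P,
      ι₀ ((Φ.symm (Ideal.Quotient.mk (Ideal.span {(PowerSeries.X ^ m + PowerSeries.C (p : ℤ_[p]) : IwasawaAlgebra p)}) PowerSeries.X • y) : ↥𝒮) : H₁) =
        θ (ι₀ ((Φ.symm y : ↥𝒮) : H₁)) - ι₀ ((Φ.symm y : ↥𝒮) : H₁))
    (hSel : ∀ a ∈ 𝒮, ι₀ a ∈ V.selmerInfty κ) (c : ℕ)
    (hfin : Finite (↥(((V.conjSelmerInfty κ γ - 1) ^ m + (p : AddMonoid.End (V.selmerInfty κ))).ker) ⧸ ((𝒮.map ι₀).comap (V.selmerInfty κ).subtype).addSubgroupOf (((V.conjSelmerInfty κ γ - 1) ^ m + (p : AddMonoid.End (V.selmerInfty κ))).ker)))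
    (hidx : Nat.card (↥(((V.conjSelmerInfty κ γ - 1) ^ m + (p : AddMonoid.End (V.selmerInfty κ))).ker) ⧸ ((𝒮.map ι₀).comap (V.selmerInfty κ).subtype).addSubgroupOf (((V.conjSelmerInfty κ γ - 1) ^ m + (p : AddMonoid.End (V.selmerInfty κ))).ker)) ≤ c) :
    ∃ h : (𝒳.X ⧸ ((Ideal.span {(PowerSeries.X ^ m + PowerSeries.C (p : ℤ_[p]) : IwasawaAlgebra p)}) : Ideal (IwasawaAlgebra p)) • (⊤ : Submodule (IwasawaAlgebra p) 𝒳.X)) →ₗ[IwasawaAlgebra p]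
        CharacterModule P,
      Finite (LinearMap.ker h) ∧ Nat.card (LinearMap.ker h) ≤ c := by
  -- the comparison `ι𝒜 := ι₀ ∘ Φ⁻¹ : P → Sel_∞` (lands in `Sel_∞` by (hSel))
  let ι𝒜 : P →+ V.selmerInfty κ :=
    (ι₀.comp (𝒮.subtype.comp Φ.symm.toAddMonoidHom)).codRestrict (V.selmerInfty κ) (fun y ↦ hSel _ (Φ.symm y).2)
  have hι𝒜_coe : ∀ y, (ι𝒜 y : V.subgroupH1 p κ.kerSubgroup) = ι₀ ((Φ.symm y : ↥𝒮) : H₁) := fun _ ↦ rfl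
  -- (hT) ⟹ `ι𝒜 (T • y) = (conj_γ - 1) (ι𝒜 y)`
  have hT' : ∀ y : P, ι𝒜 ((PowerSeries.X : IwasawaAlgebra p) • y) = (V.conjSelmerInfty κ γ - 1) (ι𝒜 y) := by
    intro y
    apply Subtype.ext
    rw [hι𝒜_coe, hsmul, hT, ← hι𝒜_coe, IwasawaDual.End_sub_apply, AddMonoid.End.one_apply, AddSubgroupClass.coe_sub,
      WeierstrassCurve.coe_conjSelmerInfty_apply, hθ]
  -- `P` is `p`- and `T`-power torsion as a `Λ`-module (`T̄, p ∈ 𝔪 = (π)`)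
  have hX𝔪 : Ideal.Quotient.mk (Ideal.span {(PowerSeries.X ^ m + PowerSeries.C (p : ℤ_[p]) : IwasawaAlgebra p)}) PowerSeries.X ∈ Ideal.span {π} := by
    rw [← hunif]; exact mk_X_mem_maximalIdeal hm
  have hp𝔪 : ((p : (IwasawaAlgebra p ⧸ Ideal.span {(PowerSeries.X ^ m + PowerSeries.C (p : ℤ_[p]) : IwasawaAlgebra p)}))) ∈ Ideal.span {π} := by
    rw [← hunif]; exact natCast_p_mem_maximalIdeal hm
  have htor : ∀ y : P, ∃ N : ℕ, p ^ N • y = 0 ∧ (PowerSeries.X : IwasawaAlgebra p) ^ N • y = 0 := by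
    intro y
    obtain ⟨N, hN⟩ := hPtor y
    refine ⟨N, ?_, ?_⟩
    · rw [← Nat.cast_smul_eq_nsmul (IwasawaAlgebra p ⧸ Ideal.span {(PowerSeries.X ^ m + PowerSeries.C (p : ℤ_[p]) : IwasawaAlgebra p)}), Nat.cast_pow]
      exact pow_smul_eq_zero_of_mem_span hp𝔪 hN
    · rw [hsmul, map_pow]
      exact pow_smul_eq_zero_of_mem_span hX𝔪 hN
  -- `ψ_m` kills `ι𝒜(P)`: `(T^m + p) • y = 0` in `P`
  have h0 : Ideal.Quotient.mk (Ideal.span {(PowerSeries.X ^ m + PowerSeries.C (p : ℤ_[p]) : IwasawaAlgebra p)}) ((PowerSeries.X : IwasawaAlgebra p) ^ m + (p : IwasawaAlgebra p)) = 0 := by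
    rw [Ideal.Quotient.eq_zero_iff_mem, ← map_natCast (PowerSeries.C : ℤ_[p] →+* IwasawaAlgebra p) p]
    exact Ideal.mem_span_singleton_self _
  have hkill : ∀ b : P, ((PowerSeries.X : IwasawaAlgebra p) ^ m + (p : IwasawaAlgebra p)) • b = 0 := by
    intro b
    rw [hsmul, h0]
    exact zero_smul (IwasawaAlgebra p ⧸ Ideal.span {(PowerSeries.X ^ m + PowerSeries.C (p : ℤ_[p]) : IwasawaAlgebra p)}) b
  have hι : ∀ b : P, ((V.conjSelmerInfty κ γ - 1) ^ m + (p : AddMonoid.End (V.selmerInfty κ))) (ι𝒜 b) = 0 :=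
    fun b ↦ psi_apply_eq_zero_of_X_compat m V γ ι𝒜 hT' b (hkill b)
  -- `Λ`-compatibility (p665265) and the dual control map (p643117)
  have hιΛ := 𝒳.toDual_smul_apply_eq_of_X_compat hγ ι𝒜 hT' htor
  obtain ⟨h, -, hcard, hfiniff⟩ := 𝒳.exists_linearMap_quotSMulTop_qm_characterModule m ι𝒜 hι hιΛ
  -- `range ι𝒜 = ι₀(𝒮) ∩ Sel_∞` (`Φ` is onto)
  have hrange : ι𝒜.range = (𝒮.map ι₀).comap (V.selmerInfty κ).subtype := by
    ext s
    constructor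
    · rintro ⟨y, rfl⟩
      exact ⟨_, (Φ.symm y).2, rfl⟩
    · rintro ⟨a, ha, has⟩
      refine ⟨Φ ⟨a, ha⟩, Subtype.ext ?_⟩
      rw [hι𝒜_coe, AddEquiv.symm_apply_apply]
      exact has
  rw [hrange] at hcard hfiniff
  exact ⟨h, hfiniff.mpr hfin, hcard ▸ hidx⟩

/-! ## §3 The turnkey -/

set_option maxHeartbeats 800000 in
set_option synthInstance.maxHeartbeats 200000 in
/-- **A `SpecWitness` at `q_m` from Howard's Thm 1.6.1 conclusion (unopened), the compact glue and a readout of the discrete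
Selmer module with (hT)/(hSel)/(hfin, hidx)** — see the module docstring. GENERIC in the `DVRSetting` over `S_m`.
[cite: Howard2004HeegnerKolyvagin, Thm. 1.6.1, Prop. 2.2.8 and proof of Thm. 2.2.10 (𝔮 = T^m + p)]
[cite: GreenbergLNM1716, §4 p. 98] [cite: MastellaZerman2026, Thm. 2.40] -/
theorem nonempty_specWitness_of_dvrConclusion_of_readout {p : ℕ} [hp : Fact p.Prime] {m : ℕ} (hm : 1 ≤ m)
    [IsDomain (IwasawaAlgebra p ⧸
      Ideal.span {(PowerSeries.X ^ m + PowerSeries.C (p : ℤ_[p]) : IwasawaAlgebra p)})]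
    [IsDiscreteValuationRing (IwasawaAlgebra p ⧸
      Ideal.span {(PowerSeries.X ^ m + PowerSeries.C (p : ℤ_[p]) : IwasawaAlgebra p)})]
    -- the frame module `𝔖 ⊇ Λκ_∞`
    {S : Type} [AddCommGroup S] [Module (IwasawaAlgebra p) S] (L : Submodule (IwasawaAlgebra p) S)
    -- the number field, the curve over it, the `ℤ_p`-extension with a topological generator, the dual Selmer datum `𝒳`
    {K : Type} [Field K] [NumberField K] (V : WeierstrassCurve K) [V.IsElliptic] {κ : ZpExtension K p}
    {γ : absoluteGaloisGroup K} (hγ : κ.IsTopGenerator γ) (𝒳 : V.SelmerDualData κ γ)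
    -- a DVR setting over `S_m`
    {N : ℕ → Type} [∀ k, AddCommGroup (N k)] [∀ k, TopologicalSpace (N k)]
    [∀ k, DiscreteTopology (N k)]
    [∀ k, Module (IwasawaAlgebra p ⧸
      Ideal.span {(PowerSeries.X ^ m + PowerSeries.C (p : ℤ_[p]) : IwasawaAlgebra p)}) (N k)]
    {Rk : ℕ → Type} [∀ k, CommRing (Rk k)] [∀ k, IsLocalRing (Rk k)] [∀ k, TopologicalSpace (Rk k)]
    [∀ k, DiscreteTopology (Rk k)] [∀ k, Algebra ℤ_[p] (Rk k)]
    [∀ k, Algebra (IwasawaAlgebra p ⧸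
      Ideal.span {(PowerSeries.X ^ m + PowerSeries.C (p : ℤ_[p]) : IwasawaAlgebra p)}) (Rk k)]
    [∀ k, Module (Rk k) (N k)]
    [∀ k, IsScalarTower (IwasawaAlgebra p ⧸
      Ideal.span {(PowerSeries.X ^ m + PowerSeries.C (p : ℤ_[p]) : IwasawaAlgebra p)}) (Rk k) (N k)]
    {Nbar : Type} [AddCommGroup Nbar] [TopologicalSpace Nbar] [DiscreteTopology Nbar]
    [∀ k, Module (Rk k) Nbar]
    {Nq : ℕ → Finset (HeightOneSpectrum (𝓞 K)) → Type} [∀ k n, AddCommGroup (Nq k n)]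
    [∀ k n, TopologicalSpace (Nq k n)] [∀ k n, DiscreteTopology (Nq k n)]
    [∀ k n, Module (Rk k) (Nq k n)]
    [∀ k n, Module (IwasawaAlgebra p ⧸
      Ideal.span {(PowerSeries.X ^ m + PowerSeries.C (p : ℤ_[p]) : IwasawaAlgebra p)}) (Nq k n)]
    [∀ k n, IsScalarTower (IwasawaAlgebra p ⧸
      Ideal.span {(PowerSeries.X ^ m + PowerSeries.C (p : ℤ_[p]) : IwasawaAlgebra p)}) (Rk k) (Nq k n)]
    (St : DVRSetting p K (IwasawaAlgebra p ⧸
      Ideal.span {(PowerSeries.X ^ m + PowerSeries.C (p : ℤ_[p]) : IwasawaAlgebra p)}) N Rk Nbar Nq)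
    (hy : St.SatisfiesH)
    (hπ : St.π ∈ IsLocalRing.maximalIdeal (IwasawaAlgebra p ⧸
      Ideal.span {(PowerSeries.X ^ m + PowerSeries.C (p : ℤ_[p]) : IwasawaAlgebra p)}))
    (he : ∀ k, St.e k ≤ St.e (k + 1))
    -- the bottom class and Howard's conclusion at it (UNOPENED)
    (one : ∀ k, galoisCohomology (St.T.ρ k) 1) (hone_mem : one ∈ St.T.limitSelmer fun k => (St.t k).cond)
    (hone : one ≠ 0) (hconc : St.Conclusion hy one)
    -- glue (compact side): an honest `S_m`-module `H` identified with `lim_k H¹_F(K, T_k)`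
    {H : Type} [AddCommGroup H] [Module (IwasawaAlgebra p) H]
    [Module (IwasawaAlgebra p ⧸
      Ideal.span {(PowerSeries.X ^ m + PowerSeries.C (p : ℤ_[p]) : IwasawaAlgebra p)}) H]
    [IsScalarTower (IwasawaAlgebra p) (IwasawaAlgebra p ⧸
      Ideal.span {(PowerSeries.X ^ m + PowerSeries.C (p : ℤ_[p]) : IwasawaAlgebra p)}) H]
    (ι : H →+ (∀ k, galoisCohomology (St.T.ρ k) 1)) (hι_inj : Function.Injective ι)
    (hι_range : ∀ y, y ∈ St.T.limitSelmer (fun k => (St.t k).cond) ↔ y ∈ Set.range ι)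
    (hι_smul : ∀ (r : IwasawaAlgebra p ⧸
        Ideal.span {(PowerSeries.X ^ m + PowerSeries.C (p : ℤ_[p]) : IwasawaAlgebra p)}) (y : H),
      ι (r • y) = St.T.smulFamily r (ι y))
    -- S1 compact control
    (f : S →ₗ[IwasawaAlgebra p] H) (κ₁ : H) (hκ₁ : ι κ₁ = one) (hL : L.map f ≤ (IwasawaAlgebra p) ∙ κ₁)
    (c : ℕ) (hcoker : Finite (H ⧸ LinearMap.range f)) (hcoker_le : Nat.card (H ⧸ LinearMap.range f) ≤ c)
    -- S1 discrete side: the READOUT of `H¹(K, A)` into `H¹(K_∞, E[p^∞])` and its three properties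
    (ι₀ : AdicTower.H1A St.T St.π St.e hy.killed hy.ker_red hπ he →+ V.subgroupH1 p κ.kerSubgroup)
    (θ : AddMonoid.End (V.subgroupH1 p κ.kerSubgroup)) (hθ : ∀ s, θ s = V.conjH1 p κ.kerSubgroup γ s)
    (hT : ∀ (j : ℕ) (cj : galoisCohomology (St.T.ρ j) 1),
      ι₀ (AddCommGroup.DirectLimit.of (fun k => galoisCohomology (St.T.ρ k) 1)
            (AdicTower.incH1LE St.T St.π St.e hy.killed hy.ker_red hπ he) j
            (scalarMapH1 _ (St.T.hlin j)
              (Ideal.Quotient.mk (Ideal.span {(PowerSeries.X ^ m + PowerSeries.C (p : ℤ_[p]) : IwasawaAlgebra p)})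
                PowerSeries.X) cj)) =
        θ (ι₀ (AddCommGroup.DirectLimit.of (fun k => galoisCohomology (St.T.ρ k) 1)
            (AdicTower.incH1LE St.T St.π St.e hy.killed hy.ker_red hπ he) j cj)) -
          ι₀ (AddCommGroup.DirectLimit.of (fun k => galoisCohomology (St.T.ρ k) 1)
            (AdicTower.incH1LE St.T St.π St.e hy.killed hy.ker_red hπ he) j cj))
    (hSel : ∀ a ∈ St.T.selmerA St.π St.e hy.killed hy.ker_red hπ he (fun k => (St.t k).cond),
      ι₀ a ∈ V.selmerInfty κ)
    (hfin : Finite (↥(((V.conjSelmerInfty κ γ - 1) ^ m + (p : AddMonoid.End (V.selmerInfty κ))).ker) ⧸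
      (((St.T.selmerA St.π St.e hy.killed hy.ker_red hπ he (fun k => (St.t k).cond)).map ι₀).comap
          (V.selmerInfty κ).subtype).addSubgroupOf
        (((V.conjSelmerInfty κ γ - 1) ^ m + (p : AddMonoid.End (V.selmerInfty κ))).ker)))
    (hidx : Nat.card (↥(((V.conjSelmerInfty κ γ - 1) ^ m + (p : AddMonoid.End (V.selmerInfty κ))).ker) ⧸
      (((St.T.selmerA St.π St.e hy.killed hy.ker_red hπ he (fun k => (St.t k).cond)).map ι₀).comap
          (V.selmerInfty κ).subtype).addSubgroupOf
        (((V.conjSelmerInfty κ γ - 1) ^ m + (p : AddMonoid.End (V.selmerInfty κ))).ker)) ≤ c) :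
    Nonempty (SpecWitness (IwasawaAlgebra p) S 𝒳.X L
      (PowerSeries.X ^ m + PowerSeries.C (p : ℤ_[p]) : IwasawaAlgebra p) c) := by
  -- (ii)/(iii) opened in honest-module currency (p664928)
  obtain ⟨x, hfree, M, iM₁, iM₂, iM₃, Φ, -, hrep, hbound⟩ :=
    DVRSetting.Conclusion.exists_semilinear St hy hπ he hconc
  -- (hT) on representatives ⟹ (hT) on `𝒟 × (M × M)` through `Φ⁻¹` (its `S_m`-semilinearity)
  have hTP : ∀ y : (FracModR (IwasawaAlgebra p ⧸ Ideal.span {(PowerSeries.X ^ m + PowerSeries.C (p : ℤ_[p]) : IwasawaAlgebra p)}) × (M × M)),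
      ι₀ ((Φ.symm (Ideal.Quotient.mk (Ideal.span {(PowerSeries.X ^ m + PowerSeries.C (p : ℤ_[p]) : IwasawaAlgebra p)}) PowerSeries.X • y) : ↥(St.T.selmerA St.π St.e hy.killed hy.ker_red hπ he (fun k => (St.t k).cond))) : (AdicTower.H1A St.T St.π St.e hy.killed hy.ker_red hπ he)) =
        θ (ι₀ ((Φ.symm y : ↥(St.T.selmerA St.π St.e hy.killed hy.ker_red hπ he (fun k => (St.t k).cond))) : (AdicTower.H1A St.T St.π St.e hy.killed hy.ker_red hπ he))) - ι₀ ((Φ.symm y : ↥(St.T.selmerA St.π St.e hy.killed hy.ker_red hπ he (fun k => (St.t k).cond))) : (AdicTower.H1A St.T St.π St.e hy.killed hy.ker_red hπ he)) := by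
    intro y
    obtain ⟨j, cj, hjc⟩ := AdicTower.exists_of_eq St.T St.π St.e hy.killed hy.ker_red hπ he
      ((Φ.symm y : ↥(St.T.selmerA St.π St.e hy.killed hy.ker_red hπ he (fun k => (St.t k).cond))) : (AdicTower.H1A St.T St.π St.e hy.killed hy.ker_red hπ he))
    have hc : (AddCommGroup.DirectLimit.of (fun k => galoisCohomology (St.T.ρ k) 1) (AdicTower.incH1LE St.T St.π St.e hy.killed hy.ker_red hπ he) j) cj ∈ (St.T.selmerA St.π St.e hy.killed hy.ker_red hπ he (fun k => (St.t k).cond)) := hjc ▸ (Φ.symm y).2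
    have hy' : Φ ⟨_, hc⟩ = y := by
      have h1 : (⟨_, hc⟩ : ↥(St.T.selmerA St.π St.e hy.killed hy.ker_red hπ he (fun k => (St.t k).cond))) = Φ.symm y := Subtype.ext hjc
      rw [h1, AddEquiv.apply_symm_apply]
    have hr : ((Φ.symm (Ideal.Quotient.mk (Ideal.span {(PowerSeries.X ^ m + PowerSeries.C (p : ℤ_[p]) : IwasawaAlgebra p)}) PowerSeries.X • y) : ↥(St.T.selmerA St.π St.e hy.killed hy.ker_red hπ he (fun k => (St.t k).cond))) : (AdicTower.H1A St.T St.π St.e hy.killed hy.ker_red hπ he)) =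
        (AddCommGroup.DirectLimit.of (fun k => galoisCohomology (St.T.ρ k) 1) (AdicTower.incH1LE St.T St.π St.e hy.killed hy.ker_red hπ he) j) (scalarMapH1 _ (St.T.hlin j) (Ideal.Quotient.mk (Ideal.span {(PowerSeries.X ^ m + PowerSeries.C (p : ℤ_[p]) : IwasawaAlgebra p)}) PowerSeries.X) cj) := by
      conv_lhs => rw [← hy']
      exact hrep j _ cj hc
    rw [hr, hT, hjc]
  -- `Λ` acts on `𝒜 := 𝒟 × (M × M)` through `Λ → S_m`
  letI instΛ : Module (IwasawaAlgebra p) (FracModR (IwasawaAlgebra p ⧸ Ideal.span {(PowerSeries.X ^ m + PowerSeries.C (p : ℤ_[p]) : IwasawaAlgebra p)}) × (M × M)) := Module.compHom _ (Ideal.Quotient.mk (Ideal.span {(PowerSeries.X ^ m + PowerSeries.C (p : ℤ_[p]) : IwasawaAlgebra p)}))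
  -- the dual control map (setting-free §2; `𝒟 × (M × M)` is `π`-power torsion, p665691)
  obtain ⟨h, hker, hker_le⟩ := exists_linearMap_characterModule_of_readout hm V hγ 𝒳 hy.unif (fun _ _ ↦ rfl)
    (FracModR.exists_pow_smul_prod_eq_zero (IwasawaAlgebra p ⧸ Ideal.span {(PowerSeries.X ^ m + PowerSeries.C (p : ℤ_[p]) : IwasawaAlgebra p)}) hy.unif) (St.T.selmerA St.π St.e hy.killed hy.ker_red hπ he (fun k => (St.t k).cond)) Φ ι₀ θ hθ hTP hSel c hfin hidx
  haveI := hker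
  exact nonempty_specWitness_of_dvrConclusion_one hm L St one hone_mem hone x hfree
    (LinearEquiv.refl (IwasawaAlgebra p ⧸ Ideal.span {(PowerSeries.X ^ m + PowerSeries.C (p : ℤ_[p]) : IwasawaAlgebra p)}) (FracModR (IwasawaAlgebra p ⧸ Ideal.span {(PowerSeries.X ^ m + PowerSeries.C (p : ℤ_[p]) : IwasawaAlgebra p)}) × (M × M))) hbound ι hι_inj hι_range hι_smul f κ₁ hκ₁ hL c hcoker hcoker_le h hker hker_le

end Summit.BirchSwinnertonDyer.BirchSwinnertonDyer.Theorems.HeegnerMuPartStabilized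

end
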